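import Literature.Computability.FineGrained.IPRenameDrivers
import Literature.Computability.FineGrained.CompactionMachine
import HarnessLib

/-!
# The renaming machine of Impagliazzo–Paturi's Lemma 2, X: bricks for the occurrence table (binary increment, record lookup, light test, least free colour)

Family `fine-grained` (trunk T-CPLX-FINE). Tenth file of the machine half of Impagliazzo–Paturi's Lemma 2. The emission half
(`IPRenameDrivers.lean`, `runs_emitOut`) needs the tables of `P`, `F` in registers; this and the
following files build them from the input formula. Here: generic bricks.

* `incrG c f j` / **`runs_incrG`** — schoolbook binary increment of a numeral register over any
  register type (as `CompactionMachine.incr`, made generic): `bits m ↦ bits (m + 1)`;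
* record tables `wRecs recs` (key numeral, comma, blank-free payload, blank; `recPay`, `recHas`),
  `findRec src` / **`runs_findRec`** (+ hypothesis form `runs_findRec'`): with the probe `rbits ν`
  in `pr`, `key := recPay recs ν`, `fnd := recHas recs ν`;
* `leCap cap` / **`runs_leCap`** (is a unary count at most `cap`; the bound is baked into the
  program), colour lists `wCols`, `moveKets`, `memPass` / **`runs_memPass`** (membership of a unary
  colour in a colour list, by `cmpU`), `freshCol` / **`runs_freshCol`** (the least free colour
  `IPRename.freshNat`, by a `whileLoop` whose iteration count is `freshNat L + 1`).

## References

* R. Impagliazzo, R. Paturi, *On the complexity of k-SAT*, J. Comput. System Sci. 62 (2001)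
  367–375, doi:10.1006/jcss.2000.1727, Lemma 2 (p. 373) and its "Moreover" sentence (the
  reduction is computable within the stated time); pp. 371–372 (`G_x`, `Ψ`, `Θ_i`, `Φ_f`).
  (Not held; acquisition request acq-00143.)
* T. Nipkow, G. Klein, *Concrete Semantics with Isabelle/HOL*, Springer 2014, Ch. 7 (big-step
  reasoning about loops, as in `SymbolPrograms.lean`).
-/

namespace Literature.Computability.FineGrained.IPRenameM

open _root_.Computability Complexity Complexity.ACom Sparsifier IPRename
open Compaction (uflag uflag_true uflag_false)

/-! ### Generic binary increment of a numeral register -/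

section IncrG

variable {ι : Type} [DecidableEq ι]

/-- Body of the increment loop over the numeral register (carry flag in `f`, result reversed on
`j`): digit `b` with carry `c` gives digit `b xor c` and carry `b and c`. (As `incBody` of
`CompactionMachine.lean`, over arbitrary registers.) [folklore] -/
def incBodyG (f j : ι) (a : Γ') : ACom Γ' ι :=
  pop f fun o => match o with
    | some _ => (match a with
        | Γ'.bit true => push j (Γ'.bit false) ;; push f Γ'.blank
        | _ => push j (Γ'.bit true))
    | none => push j a

/-- `incrG c f j`: replace the numeral `bits m` in `c` by `bits (m + 1)` (schoolbook increment,
least significant digit first; `TokConv.incRes`). Requires `f = j = []`. [folklore] -/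
def incrG (c f j : ι) : ACom Γ' ι :=
  push f Γ'.blank ;; loop c (incBodyG f j) ;;
  pop f (fun o => match o with
    | some _ => push j (Γ'.bit true)
    | none => skip) ;;
  pour j c

variable {c f j : ι} (hcf : c ≠ f) (hcj : c ≠ j) (hfj : f ≠ j)
include hcf hcj hfj

/-- The store after the carry pass. [folklore] -/
def incSt (R : AStore Γ' ι) (cw : List Γ') (cy : Bool) (jw : List Γ') : AStore Γ' ι := fun r =>
  if r = c then cw else if r = f then uflag cy else if r = j then jw else R r

omit hcf hcj hfj in
/-- Reading `c`. [folklore] -/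
theorem incSt_c (R : AStore Γ' ι) (cw : List Γ') (cy : Bool) (jw : List Γ') : incSt (c := c) (f := f) (j := j) R cw cy jw c = cw := by
  simp [incSt]

omit hcj hfj in
/-- Reading `f`. [folklore] -/
theorem incSt_f (R : AStore Γ' ι) (cw : List Γ') (cy : Bool) (jw : List Γ') : incSt (c := c) (f := f) (j := j) R cw cy jw f = uflag cy := by
  simp [incSt, hcf.symm]

omit hcf in
/-- Reading `j`. [folklore] -/
theorem incSt_j (R : AStore Γ' ι) (cw : List Γ') (cy : Bool) (jw : List Γ') : incSt (c := c) (f := f) (j := j) R cw cy jw j = jw := by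
  simp [incSt, hcj.symm, hfj.symm]

omit hcf hcj hfj in
/-- Updating `c`. [folklore] -/
theorem update_incSt_c (R : AStore Γ' ι) (cw : List Γ') (cy : Bool) (jw u : List Γ') :
    Function.update (incSt (c := c) (f := f) (j := j) R cw cy jw) c u = incSt (c := c) (f := f) (j := j) R u cy jw := by
  funext r; by_cases h : r = c
  · subst h; simp [incSt]
  · rw [Function.update_of_ne h]; simp [incSt, h]

omit hcj hfj in
/-- Updating `f`. [folklore] -/
theorem update_incSt_f (R : AStore Γ' ι) (cw : List Γ') (cy cy' : Bool) (jw : List Γ') :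
    Function.update (incSt (c := c) (f := f) (j := j) R cw cy jw) f (uflag cy') = incSt (c := c) (f := f) (j := j) R cw cy' jw := by
  funext r; by_cases h : r = f
  · subst h; simp [incSt, hcf.symm]
  · rw [Function.update_of_ne h]; simp [incSt, h]

omit hcf in
/-- Updating `j`. [folklore] -/
theorem update_incSt_j (R : AStore Γ' ι) (cw : List Γ') (cy : Bool) (jw u : List Γ') :
    Function.update (incSt (c := c) (f := f) (j := j) R cw cy jw) j u = incSt (c := c) (f := f) (j := j) R cw cy u := by
  funext r; by_cases h : r = j
  · subst h; simp [incSt, hcj.symm, hfj.symm]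
  · rw [Function.update_of_ne h]; simp [incSt, h]

/-- The increment loop computes the carry pass (`TokConv.ib`, `TokConv.co`). [folklore] -/
theorem runs_incLoopG (R : AStore Γ' ι) : ∀ (w : List Bool) (cy : Bool) (jw : List Γ'),
    Runs (loop c (incBodyG f j)) (incSt (c := c) (f := f) (j := j) R (w.map Γ'.bit) cy jw)
      (incSt (c := c) (f := f) (j := j) R [] (TokConv.co cy w) (((TokConv.ib cy w).map Γ'.bit).reverse ++ jw))
      (6 * w.length + 1)
  | [], cy, jw => by
    refine (Runs.loop_nil (incBodyG f j) (R := incSt R ([].map Γ'.bit) cy jw) (by simp [incSt_c])).of_eq ?_ (by simp)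
    simp [TokConv.ib, TokConv.co]
  | b :: w, cy, jw => by
    have hc : incSt (c := c) (f := f) (j := j) R ((b :: w).map Γ'.bit) cy jw c = Γ'.bit b :: w.map Γ'.bit := by simp [incSt_c]
    have hbody : Runs (incBodyG f j (Γ'.bit b)) (Function.update (incSt (c := c) (f := f) (j := j) R ((b :: w).map Γ'.bit) cy jw) c (w.map Γ'.bit))
        (incSt (c := c) (f := f) (j := j) R (w.map Γ'.bit) (b && cy) (Γ'.bit (b ^^ cy) :: jw)) 4 := by
      rw [update_incSt_c]; unfold incBodyG
      cases cy with
      | false =>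
        refine (Runs.pop_nil (by rw [incSt_f hcf]; rfl) (Runs.push' ?_)).mono (by norm_num)
        rw [incSt_j hcj hfj, update_incSt_j hcj hfj]
        cases b <;> rfl
      | true =>
        have hk : incSt (c := c) (f := f) (j := j) R (w.map Γ'.bit) true jw f = Γ'.blank :: [] := by rw [incSt_f hcf]; rfl
        cases b with
        | true =>
          refine (Runs.pop_cons hk ?_).mono (show 2 + 2 ≤ 4 by norm_num)
          rw [show ([] : List Γ') = uflag false from rfl, update_incSt_f hcf]
          refine ((Runs.push j (Γ'.bit false) _).seq (Runs.push' ?_)).of_eq rfl (by norm_num)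
          rw [incSt_j hcj hfj, update_incSt_j hcj hfj, incSt_f hcf, show Γ'.blank :: uflag false = uflag true from rfl,
            update_incSt_f hcf]
          rfl
        | false =>
          refine (Runs.pop_cons hk (Runs.push' ?_)).mono (show 1 + 2 ≤ 4 by norm_num)
          rw [show ([] : List Γ') = uflag false from rfl, update_incSt_f hcf, incSt_j hcj hfj, update_incSt_j hcj hfj]
          rfl
    have ih := runs_incLoopG R w (b && cy) (Γ'.bit (b ^^ cy) :: jw)
    refine (Runs.loop_cons hc hbody ih).of_eq ?_ ?_
    · simp [TokConv.ib, TokConv.co]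
    · simp only [List.length_cons]; omega

/-- **Specification of `incrG`.** With `c = bits m` and `f = j = []`, `incrG` sets `c` to
`bits (m + 1)` within `9 |bits m| + 9` steps. [folklore] -/
theorem runs_incrG (m : ℕ) (R : AStore Γ' ι) (hc : R c = (encodeNat m).map Γ'.bit) (hf : R f = []) (hj : R j = []) :
    Runs (incrG c f j) R (Function.update R c ((encodeNat (m + 1)).map Γ'.bit)) (9 * (encodeNat m).length + 9) := by
  set w := encodeNat m with hw
  rw [TokConv.encodeNat_succ_eq_incRes, ← hw]
  have e : incSt (c := c) (f := f) (j := j) R (w.map Γ'.bit) false [] = R := by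
    funext r
    by_cases h1 : r = c; · subst h1; rw [incSt_c, hc]
    by_cases h2 : r = f; · subst h2; rw [incSt_f hcf, hf]; rfl
    by_cases h3 : r = j; · subst h3; rw [incSt_j hcj hfj, hj]
    simp [incSt, h1, h2, h3]
  unfold incrG
  have e1 : Runs (push f Γ'.blank) R (incSt (c := c) (f := f) (j := j) R (w.map Γ'.bit) true []) 1 := by
    refine Runs.push' ?_
    have : Function.update (incSt (c := c) (f := f) (j := j) R (w.map Γ'.bit) false []) f (uflag true) =
        incSt (c := c) (f := f) (j := j) R (w.map Γ'.bit) true [] := update_incSt_f hcf _ _ _ _ _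
    rw [e] at this
    rw [hf]; exact this
  have e2 := runs_incLoopG hcf hcj hfj R w true []
  rw [List.append_nil] at e2
  have e3 : Runs (pop f fun o => match o with
      | some _ => push j (Γ'.bit true)
      | none => skip) (incSt (c := c) (f := f) (j := j) R [] (TokConv.co true w) ((TokConv.ib true w).map Γ'.bit).reverse)
      (incSt (c := c) (f := f) (j := j) R [] false ((TokConv.incRes true w).map Γ'.bit).reverse) 3 := by
    cases hco : TokConv.co true w with
    | true =>
      refine (Runs.pop_cons (k := f) (a := Γ'.blank) (w := []) (by rw [incSt_f hcf]; rfl) (Runs.push' ?_)).mono (by norm_num)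
      rw [show ([] : List Γ') = uflag false from rfl, update_incSt_f hcf, incSt_j hcj hfj, update_incSt_j hcj hfj]
      simp [TokConv.incRes, hco, Literature.Computability.Complexity.flag]
    | false =>
      refine (Runs.pop_nil (by rw [incSt_f hcf]; rfl) ((Runs.skip _).of_eq ?_ le_rfl)).mono (by norm_num)
      simp [TokConv.incRes, hco, Literature.Computability.Complexity.flag]
  have e4 := runs_pour (a := j) (b := c) hcj.symm (incSt (c := c) (f := f) (j := j) R [] false ((TokConv.incRes true w).map Γ'.bit).reverse)
  rw [incSt_j hcj hfj, incSt_c, List.length_reverse, List.reverse_reverse, List.append_nil, update_incSt_j hcj hfj, update_incSt_c] at e4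
  refine (e1.seq (e2.seq (e3.seq e4))).of_eq ?_ ?_
  · conv_rhs => rw [← e]
    rw [update_incSt_c]
  · have := TokConv.length_incRes_le true w
    simp only [List.length_map]
    omega

end IncrG

/-! ### Record tables and their lookup -/

/-- The word of a record table: each record is its key numeral, a comma, its (blank-free) payload,
a blank. [folklore] -/
def wRecs (recs : List (ℕ × List Γ')) : List Γ' :=
  recs.flatMap fun r => (encodeNat r.1).map Γ'.bit ++ Γ'.comma :: (r.2 ++ [Γ'.blank])

/-- The payload of the first record with key `ν` (empty if none). [folklore] -/
def recPay (recs : List (ℕ × List Γ')) (ν : ℕ) : List Γ' :=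
  ((recs.find? fun r => r.1 == ν).map Prod.snd).getD []

/-- Whether some record has key `ν`. [folklore] -/
def recHas (recs : List (ℕ × List Γ')) (ν : ℕ) : Bool := recs.any fun r => r.1 == ν

/-- At the comma closing a key: unless a record was found already, compare the key (reversed, in
`ex`) with the probe (in `pr`), and on a match raise the copy flag `eb`; empty `ex`. [folklore] -/
def frComma : RProg :=
  ifTop (kr KR.fnd) (fun o => match o with
    | some _ => skip
    | none => (eqW Γ'.blank).map embEq ;; pop (kr KR.ne) fun o' => match o' with
        | some _ => skip
        | none => push (kr KR.eb) Γ'.blank) ;;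
  clear (kr KR.ex)

/-- At the blank closing a record: if it was the match, raise `fnd` and move the staged payload to
`key`. [folklore] -/
def frEnd : RProg :=
  pop (kr KR.eb) fun o => match o with
    | some _ => push (kr KR.fnd) Γ'.blank ;; pour (kr KR.lmd) (kr KR.key)
    | none => skip

/-- Body of the record lookup over the copy `dict2`: mode `vw` empty = inside a key (bits collected
reversed in `ex`, the comma compares), `comma` = inside a payload (symbols staged in `lmd` if the
copy flag is up; the blank closes the record). [folklore] -/
def frBody (s : Γ') : RProg :=
  pop (kr KR.vw) fun o => match o, s with
    | none, Γ'.bit d => push (kr KR.ex) (Γ'.bit d)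
    | none, Γ'.comma => frComma ;; push (kr KR.vw) Γ'.comma
    | none, _ => skip
    | some _, Γ'.blank => frEnd
    | some _, t => (ifTop (kr KR.eb) fun o' => match o' with
        | some _ => push (kr KR.lmd) t
        | none => skip) ;; push (kr KR.vw) Γ'.comma

/-- `findRec src`: with the probe `rbits ν` in `pr` (kept) and a record table in `src` (kept),
set `key` to the payload of the first record with key `ν` and `fnd` to the flag "there is one".
Requires `dict2`, `vw`, `ex`, `eb`, `lmd`, `fnd`, `key`, `ne`, `x2`, `t1`, `t2` empty. [folklore] -/
def findRec (src : KR) : RProg :=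
  copyToG (kr src) (kr KR.dict2) (kr KR.t1) (kr KR.t2) ;; loop (kr KR.dict2) frBody

/-- The store family `frSt` over a base store. [folklore] -/
def frSt (S : RStore) (dict2 vw ex eb lmd fnd key ne : List Γ') : RStore := fun r =>
  if r = kr KR.dict2 then dict2 else if r = kr KR.vw then vw else if r = kr KR.ex then ex else if r = kr KR.eb then eb else if r = kr KR.lmd then lmd else if r = kr KR.fnd then fnd else if r = kr KR.key then key else if r = kr KR.ne then ne else S r

section FrstLemmas

variable (S : RStore) (dict2 vw ex eb lmd fnd key ne w : List Γ')

/-- Reading `dict2`. [folklore] -/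
@[simp] theorem frSt_dict2 : frSt S dict2 vw ex eb lmd fnd key ne (kr KR.dict2) = dict2 := by simp [frSt]
/-- Reading `vw`. [folklore] -/
@[simp] theorem frSt_vw : frSt S dict2 vw ex eb lmd fnd key ne (kr KR.vw) = vw := by simp [frSt]
/-- Reading `ex`. [folklore] -/
@[simp] theorem frSt_ex : frSt S dict2 vw ex eb lmd fnd key ne (kr KR.ex) = ex := by simp [frSt]
/-- Reading `eb`. [folklore] -/
@[simp] theorem frSt_eb : frSt S dict2 vw ex eb lmd fnd key ne (kr KR.eb) = eb := by simp [frSt]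
/-- Reading `lmd`. [folklore] -/
@[simp] theorem frSt_lmd : frSt S dict2 vw ex eb lmd fnd key ne (kr KR.lmd) = lmd := by simp [frSt]
/-- Reading `fnd`. [folklore] -/
@[simp] theorem frSt_fnd : frSt S dict2 vw ex eb lmd fnd key ne (kr KR.fnd) = fnd := by simp [frSt]
/-- Reading `key`. [folklore] -/
@[simp] theorem frSt_key : frSt S dict2 vw ex eb lmd fnd key ne (kr KR.key) = key := by simp [frSt]
/-- Reading `ne`. [folklore] -/
@[simp] theorem frSt_ne : frSt S dict2 vw ex eb lmd fnd key ne (kr KR.ne) = ne := by simp [frSt]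
/-- Reading any other register. [folklore] -/
theorem frSt_other {r : Reg} (h0 : r ≠ kr KR.dict2) (h1 : r ≠ kr KR.vw) (h2 : r ≠ kr KR.ex) (h3 : r ≠ kr KR.eb) (h4 : r ≠ kr KR.lmd) (h5 : r ≠ kr KR.fnd) (h6 : r ≠ kr KR.key) (h7 : r ≠ kr KR.ne) :
    frSt S dict2 vw ex eb lmd fnd key ne r = S r := by simp [frSt, h0, h1, h2, h3, h4, h5, h6, h7]
/-- Reading `pr`. [folklore] -/
@[simp] theorem frSt_pr : frSt S dict2 vw ex eb lmd fnd key ne (kr KR.pr) = S (kr KR.pr) := by simp [frSt]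
/-- Reading `x2`. [folklore] -/
@[simp] theorem frSt_x2 : frSt S dict2 vw ex eb lmd fnd key ne (kr KR.x2) = S (kr KR.x2) := by simp [frSt]
/-- Reading `t1`. [folklore] -/
@[simp] theorem frSt_t1 : frSt S dict2 vw ex eb lmd fnd key ne (kr KR.t1) = S (kr KR.t1) := by simp [frSt]
/-- Reading `t2`. [folklore] -/
@[simp] theorem frSt_t2 : frSt S dict2 vw ex eb lmd fnd key ne (kr KR.t2) = S (kr KR.t2) := by simp [frSt]
/-- Reading `oc`. [folklore] -/
@[simp] theorem frSt_oc : frSt S dict2 vw ex eb lmd fnd key ne (kr KR.oc) = S (kr KR.oc) := by simp [frSt]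
/-- Reading `dict`. [folklore] -/
@[simp] theorem frSt_dict : frSt S dict2 vw ex eb lmd fnd key ne (kr KR.dict) = S (kr KR.dict) := by simp [frSt]
/-- Updating `dict2`. [folklore] -/
@[simp] theorem update_frSt_dict2 : Function.update (frSt S dict2 vw ex eb lmd fnd key ne) (kr KR.dict2) w = frSt S w vw ex eb lmd fnd key ne := by
  funext r; by_cases h : r = kr KR.dict2
  · subst h; simp
  · rw [Function.update_of_ne h]; simp [frSt, h]
/-- Updating `vw`. [folklore] -/
@[simp] theorem update_frSt_vw : Function.update (frSt S dict2 vw ex eb lmd fnd key ne) (kr KR.vw) w = frSt S dict2 w ex eb lmd fnd key ne := by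
  funext r; by_cases h : r = kr KR.vw
  · subst h; simp
  · rw [Function.update_of_ne h]; simp [frSt, h]
/-- Updating `ex`. [folklore] -/
@[simp] theorem update_frSt_ex : Function.update (frSt S dict2 vw ex eb lmd fnd key ne) (kr KR.ex) w = frSt S dict2 vw w eb lmd fnd key ne := by
  funext r; by_cases h : r = kr KR.ex
  · subst h; simp
  · rw [Function.update_of_ne h]; simp [frSt, h]
/-- Updating `eb`. [folklore] -/
@[simp] theorem update_frSt_eb : Function.update (frSt S dict2 vw ex eb lmd fnd key ne) (kr KR.eb) w = frSt S dict2 vw ex w lmd fnd key ne := by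
  funext r; by_cases h : r = kr KR.eb
  · subst h; simp
  · rw [Function.update_of_ne h]; simp [frSt, h]
/-- Updating `lmd`. [folklore] -/
@[simp] theorem update_frSt_lmd : Function.update (frSt S dict2 vw ex eb lmd fnd key ne) (kr KR.lmd) w = frSt S dict2 vw ex eb w fnd key ne := by
  funext r; by_cases h : r = kr KR.lmd
  · subst h; simp
  · rw [Function.update_of_ne h]; simp [frSt, h]
/-- Updating `fnd`. [folklore] -/
@[simp] theorem update_frSt_fnd : Function.update (frSt S dict2 vw ex eb lmd fnd key ne) (kr KR.fnd) w = frSt S dict2 vw ex eb lmd w key ne := by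
  funext r; by_cases h : r = kr KR.fnd
  · subst h; simp
  · rw [Function.update_of_ne h]; simp [frSt, h]
/-- Updating `key`. [folklore] -/
@[simp] theorem update_frSt_key : Function.update (frSt S dict2 vw ex eb lmd fnd key ne) (kr KR.key) w = frSt S dict2 vw ex eb lmd fnd w ne := by
  funext r; by_cases h : r = kr KR.key
  · subst h; simp
  · rw [Function.update_of_ne h]; simp [frSt, h]
/-- Updating `ne`. [folklore] -/
@[simp] theorem update_frSt_ne : Function.update (frSt S dict2 vw ex eb lmd fnd key ne) (kr KR.ne) w = frSt S dict2 vw ex eb lmd fnd key w := by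
  funext r; by_cases h : r = kr KR.ne
  · subst h; simp
  · rw [Function.update_of_ne h]; simp [frSt, h]

end FrstLemmas

/-- Every store is a `frSt` over itself. [folklore] -/
theorem frSt_eta (R : RStore) : frSt R (R (kr KR.dict2)) (R (kr KR.vw)) (R (kr KR.ex)) (R (kr KR.eb)) (R (kr KR.lmd)) (R (kr KR.fnd)) (R (kr KR.key)) (R (kr KR.ne)) = R := by
  funext r
  by_cases h0 : r = kr KR.dict2; · subst h0; simp
  by_cases h1 : r = kr KR.vw; · subst h1; simp
  by_cases h2 : r = kr KR.ex; · subst h2; simp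
  by_cases h3 : r = kr KR.eb; · subst h3; simp
  by_cases h4 : r = kr KR.lmd; · subst h4; simp
  by_cases h5 : r = kr KR.fnd; · subst h5; simp
  by_cases h6 : r = kr KR.key; · subst h6; simp
  by_cases h7 : r = kr KR.ne; · subst h7; simp
  rw [frSt_other _ _ _ _ _ _ _ _ _ h0 h1 h2 h3 h4 h5 h6 h7]

/-! ### Specification of the record lookup -/

section FrSpec

variable (S : RStore) (ν : ℕ) (hpr : S (kr KR.pr) = rbits ν) (hx2 : S (kr KR.x2) = [])
include hpr hx2

omit hpr hx2 in
/-- Key bits are collected reversed in `ex`. [folklore] -/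
theorem segRuns_fr_bits (fnd key : List Γ') : ∀ (u : List Bool) (rest ex : List Γ'),
    SegRuns (kr KR.dict2) frBody (u.map Γ'.bit) (frSt S (u.map Γ'.bit ++ rest) [] ex [] [] fnd key [])
      (frSt S rest [] ((u.map Γ'.bit).reverse ++ ex) [] [] fnd key []) (5 * u.length)
  | [], rest, ex => by simpa using SegRuns.nil (kr KR.dict2) frBody _
  | d :: u, rest, ex => by
    have hbody : Runs (frBody (Γ'.bit d)) (Function.update (frSt S (Γ'.bit d :: (u.map Γ'.bit ++ rest)) [] ex [] [] fnd key [])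
        (kr KR.dict2) (u.map Γ'.bit ++ rest)) (frSt S (u.map Γ'.bit ++ rest) [] (Γ'.bit d :: ex) [] [] fnd key []) (1 + 2) := by
      rw [update_frSt_dict2]; unfold frBody
      exact Runs.pop_nil (by simp) (Runs.push' (by simp))
    have ih := segRuns_fr_bits fnd key u rest (Γ'.bit d :: ex)
    have hk : frSt S (Γ'.bit d :: (u.map Γ'.bit ++ rest)) [] ex [] [] fnd key [] (kr KR.dict2) = Γ'.bit d :: (u.map Γ'.bit ++ rest) := by
      simp
    refine (SegRuns.cons hk hbody ih).cast (by simp) (by simp) (by simp) ?_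
    simp only [List.length_cons]; omega

/-- **The comma of a record with key `k`**: the copy flag becomes "not found before and `k = ν`".
[folklore] -/
theorem runs_frComma (k : ℕ) (F : Bool) (key : List Γ') (dict2 : List Γ') :
    Runs frComma (frSt S dict2 [] (rbits k) [] [] (uflag F) key [])
      (frSt S dict2 [] [] (flagW Γ'.blank (F = false ∧ k = ν)) [] (uflag F) key [])
      (12 * (rbits ν).length + 4 * (rbits k).length + 18) := by
  unfold frComma
  cases F with
  | true =>
    have h1 : Runs (ifTop (kr KR.fnd) fun o => match o with
        | some _ => skip
        | none => (eqW Γ'.blank).map embEq ;; pop (kr KR.ne) fun o' => match o' with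
            | some _ => skip
            | none => push (kr KR.eb) Γ'.blank)
        (frSt S dict2 [] (rbits k) [] [] (uflag true) key []) (frSt S dict2 [] (rbits k) [] [] (uflag true) key []) 3 :=
      Runs.ifTop_cons (R := frSt S dict2 [] (rbits k) [] [] (uflag true) key []) (x := Γ'.blank) (w := []) (by simp)
        (Runs.skip (frSt S dict2 [] (rbits k) [] [] (uflag true) key []))
    have h2 := runs_clear (kr KR.ex) (frSt S dict2 [] (rbits k) [] [] (uflag true) key [])
    rw [frSt_ex, update_frSt_ex] at h2
    rw [flagW_false _ (by simp)]
    exact (h1.seq h2).mono (by omega)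
  | false =>
    have hE := runs_eqW_map (tk := Γ'.blank) embEq_injective (frSt S dict2 [] (rbits k) [] [] (uflag false) key [])
      (u := rbits ν) (v := rbits k) (by simp [embEq, hpr]) (by simp [embEq]) (by simp [embEq, hx2]) (by simp [embEq])
    have hE' : Runs ((eqW Γ'.blank).map embEq) (frSt S dict2 [] (rbits k) [] [] (uflag false) key [])
        (frSt S dict2 [] [] [] [] (uflag false) key (flagW Γ'.blank (ν ≠ k))) (12 * (rbits ν).length + 2 * (rbits k).length + 12) := by
      have hfl : flagW Γ'.blank (rbits ν ≠ rbits k) = flagW Γ'.blank (ν ≠ k) := flagW_congr _ rbits_injective.ne_iff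
      rw [hfl] at hE
      refine hE.of_eq ?_ le_rfl
      simp only [embEq]
      funext r
      by_cases h0 : r = kr KR.ne; · subst h0; simp
      rw [Function.update_of_ne h0]
      by_cases h1 : r = kr KR.x2; · subst h1; simp [hx2]
      rw [Function.update_of_ne h1]
      by_cases h2 : r = kr KR.ex; · subst h2; simp
      rw [Function.update_of_ne h2]
      by_cases h3 : r = kr KR.pr; · subst h3; simp [hpr]
      rw [Function.update_of_ne h3]
      simp [frSt, h0, h2]
    by_cases hk : k = ν
    · subst hk
      rw [flagW_false _ (by simp)] at hE'
      rw [flagW_true _ ⟨rfl, rfl⟩]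
      have h2 : Runs (pop (kr KR.ne) fun o' => match o' with
          | some _ => skip
          | none => push (kr KR.eb) Γ'.blank) (frSt S dict2 [] [] [] [] (uflag false) key [])
          (frSt S dict2 [] [] [Γ'.blank] [] (uflag false) key []) (1 + 2) :=
        Runs.pop_nil (by simp) (Runs.push' (by simp))
      have h3 := runs_clear (kr KR.ex) (frSt S dict2 [] [] [Γ'.blank] [] (uflag false) key [])
      rw [frSt_ex, update_frSt_ex] at h3
      refine ((Runs.ifTop_nil (by rw [frSt_fnd]; rfl) (hE'.seq h2)).seq h3).mono ?_
      simp; omega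
    · rw [flagW_true _ (Ne.symm hk)] at hE'
      rw [flagW_false _ (by simp [hk])]
      have h2 : Runs (pop (kr KR.ne) fun o' => match o' with
          | some _ => skip
          | none => push (kr KR.eb) Γ'.blank) (frSt S dict2 [] [] [] [] (uflag false) key [Γ'.blank])
          (frSt S dict2 [] [] [] [] (uflag false) key []) (0 + 2) :=
        Runs.pop_cons (k := kr KR.ne) (a := Γ'.blank) (w := []) (by simp) ((Runs.skip _).of_eq (by simp) le_rfl)
      have h3 := runs_clear (kr KR.ex) (frSt S dict2 [] [] [] [] (uflag false) key [])
      rw [frSt_ex, update_frSt_ex] at h3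
      refine ((Runs.ifTop_nil (by rw [frSt_fnd]; rfl) (hE'.seq h2)).seq h3).mono ?_
      simp; omega

omit hpr hx2 in
/-- **Payload symbols** are staged if the copy flag is up, skipped otherwise. [folklore] -/
theorem segRuns_fr_payload (fnd key : List Γ') (C : Bool) : ∀ (u : List Γ'), Γ'.blank ∉ u → ∀ (rest lmd : List Γ'),
    SegRuns (kr KR.dict2) frBody u (frSt S (u ++ rest) [Γ'.comma] [] (uflag C) lmd fnd key [])
      (frSt S rest [Γ'.comma] [] (uflag C) ((if C then u.reverse else []) ++ lmd) fnd key []) (9 * u.length)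
  | [], _, rest, lmd => by cases C <;> simpa using SegRuns.nil (kr KR.dict2) frBody _
  | s :: u, hu, rest, lmd => by
    have hs : s ≠ Γ'.blank := fun h => hu (by simp [h])
    have hu' : Γ'.blank ∉ u := fun h => hu (by simp [h])
    have hbody : Runs (frBody s) (Function.update (frSt S (s :: u ++ rest) [Γ'.comma] [] (uflag C) lmd fnd key []) (kr KR.dict2) (u ++ rest))
        (frSt S (u ++ rest) [Γ'.comma] [] (uflag C) ((if C then [s] else []) ++ lmd) fnd key []) ((4 + 1) + 2) := by
      rw [update_frSt_dict2]
      have hin : ∀ t : Γ', Runs ((ifTop (kr KR.eb) fun o' => match o' with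
          | some _ => push (kr KR.lmd) t
          | none => skip) ;; push (kr KR.vw) Γ'.comma) (frSt S (u ++ rest) [] [] (uflag C) lmd fnd key [])
          (frSt S (u ++ rest) [Γ'.comma] [] (uflag C) ((if C then [t] else []) ++ lmd) fnd key []) (4 + 1) := by
        intro t
        cases C with
        | true =>
          have hp : Runs (push (kr KR.lmd) t) (frSt S (u ++ rest) [] [] (uflag true) lmd fnd key [])
              (frSt S (u ++ rest) [] [] (uflag true) (t :: lmd) fnd key []) 1 := Runs.push' (by simp)
          exact (Runs.ifTop_cons (R := frSt S (u ++ rest) [] [] (uflag true) lmd fnd key []) (x := Γ'.blank) (w := [])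
            (by simp [uflag]) hp).seq (Runs.push' (by simp))
        | false =>
          exact ((Runs.ifTop_nil (R := frSt S (u ++ rest) [] [] (uflag false) lmd fnd key []) (by simp [uflag])
            (Runs.skip _)).seq (Runs.push' (by simp))).mono (by norm_num)
      unfold frBody
      cases s with
      | blank => exact absurd rfl hs
      | bit d => exact (Runs.pop_cons (k := kr KR.vw) (a := Γ'.comma) (w := []) (by simp) (by rw [update_frSt_vw]; exact hin _)).mono (by norm_num)
      | bra => exact (Runs.pop_cons (k := kr KR.vw) (a := Γ'.comma) (w := []) (by simp) (by rw [update_frSt_vw]; exact hin _)).mono (by norm_num)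
      | ket => exact (Runs.pop_cons (k := kr KR.vw) (a := Γ'.comma) (w := []) (by simp) (by rw [update_frSt_vw]; exact hin _)).mono (by norm_num)
      | comma => exact (Runs.pop_cons (k := kr KR.vw) (a := Γ'.comma) (w := []) (by simp) (by rw [update_frSt_vw]; exact hin _)).mono (by norm_num)
    have ih := segRuns_fr_payload fnd key C u hu' rest ((if C then [s] else []) ++ lmd)
    have hk : frSt S (s :: u ++ rest) [Γ'.comma] [] (uflag C) lmd fnd key [] (kr KR.dict2) = s :: (u ++ rest) := by simp
    refine (SegRuns.cons hk hbody ih).cast rfl rfl ?_ ?_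
    · cases C <;> simp
    · simp only [List.length_cons]; omega

omit hpr hx2 in
/-- **The closing blank.** [folklore] -/
theorem runs_frEnd (F C : Bool) (hFC : C = true → F = false) (key lmd dict2 : List Γ') (hkey : C = true → key = []) :
    Runs frEnd (frSt S dict2 [] [] (uflag C) lmd (uflag F) key [])
      (frSt S dict2 [] [] [] (if C then [] else lmd) (uflag (F || C)) (if C then lmd.reverse else key) []) (3 * lmd.length + 4) := by
  unfold frEnd
  cases C with
  | false =>
    refine (Runs.pop_nil (by simp) ((Runs.skip _).of_eq ?_ le_rfl)).mono (by omega)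
    simp
  | true =>
    have hF := hFC rfl; have hk := hkey rfl
    subst hF; subst hk
    refine (Runs.pop_cons (k := kr KR.eb) (a := Γ'.blank) (w := []) (by simp) ?_).mono (show (1 + (3 * lmd.length + 1)) + 2 ≤ _ by omega)
    rw [update_frSt_eb]
    refine (Runs.push' (R' := frSt S dict2 [] [] [] lmd [Γ'.blank] [] []) (by simp)).seq ?_
    have h := runs_pour (a := kr KR.lmd) (b := kr KR.key) (by simp) (frSt S dict2 [] [] [] lmd [Γ'.blank] [] [])
    rw [frSt_lmd, frSt_key, List.append_nil, update_frSt_lmd, update_frSt_key] at h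
    simpa using h

/-- **One record.** [folklore] -/
theorem segRuns_fr_record (k : ℕ) (pay : List Γ') (hpay : Γ'.blank ∉ pay) (F : Bool) (key rest : List Γ') (hkey : F = false → key = []) :
    SegRuns (kr KR.dict2) frBody ((encodeNat k).map Γ'.bit ++ Γ'.comma :: (pay ++ [Γ'.blank]))
      (frSt S ((encodeNat k).map Γ'.bit ++ Γ'.comma :: (pay ++ [Γ'.blank]) ++ rest) [] [] [] [] (uflag F) key [])
      (frSt S rest [] [] [] [] (uflag (F || (k == ν))) (if F = false ∧ k = ν then pay else key) [])
      ((12 * (rbits ν).length + 34) * ((encodeNat k).map Γ'.bit ++ Γ'.comma :: (pay ++ [Γ'.blank])).length) := by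
  have h1 := segRuns_fr_bits S (uflag F) key (encodeNat k) (Γ'.comma :: (pay ++ [Γ'.blank]) ++ rest) []
  rw [List.append_nil] at h1
  have hrb : ((encodeNat k).map Γ'.bit).reverse = rbits k := rfl
  rw [hrb] at h1
  set C : Bool := decide (F = false ∧ k = ν) with hC
  have hfl : flagW Γ'.blank (F = false ∧ k = ν) = uflag C := by
    by_cases h : F = false ∧ k = ν
    · rw [flagW_true _ h, hC, decide_eq_true h]; rfl
    · rw [flagW_false _ h, hC, decide_eq_false h]; rfl
  have h2 : Runs (frBody Γ'.comma) (Function.update (frSt S (Γ'.comma :: (pay ++ [Γ'.blank]) ++ rest) [] (rbits k) [] [] (uflag F) key [])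
      (kr KR.dict2) (pay ++ [Γ'.blank] ++ rest)) (frSt S (pay ++ [Γ'.blank] ++ rest) [Γ'.comma] [] (uflag C) [] (uflag F) key [])
      ((12 * (rbits ν).length + 4 * (rbits k).length + 18 + 1) + 2) := by
    rw [update_frSt_dict2]; unfold frBody
    refine Runs.pop_nil (by simp) ?_
    have hc := runs_frComma S ν hpr hx2 k F key (pay ++ [Γ'.blank] ++ rest)
    rw [hfl] at hc
    exact hc.seq (Runs.push' (by simp))
  have hk2 : frSt S (Γ'.comma :: (pay ++ [Γ'.blank]) ++ rest) [] (rbits k) [] [] (uflag F) key [] (kr KR.dict2) =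
      Γ'.comma :: (pay ++ [Γ'.blank] ++ rest) := by simp
  have h3 := segRuns_fr_payload S (uflag F) key C pay hpay ([Γ'.blank] ++ rest) []
  rw [List.append_nil] at h3
  have hFC : C = true → F = false := fun h => by
    rw [hC, decide_eq_true_eq] at h; exact h.1
  have hkeyC : C = true → key = [] := fun h => hkey (hFC h)
  have h4 : Runs (frBody Γ'.blank) (Function.update (frSt S ([Γ'.blank] ++ rest) [Γ'.comma] [] (uflag C) (if C then pay.reverse else [])
      (uflag F) key []) (kr KR.dict2) rest)
      (frSt S rest [] [] [] [] (uflag (F || (k == ν))) (if F = false ∧ k = ν then pay else key) []) ((3 * pay.length + 4) + 2) := by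
    rw [update_frSt_dict2]; unfold frBody
    refine Runs.pop_cons (k := kr KR.vw) (a := Γ'.comma) (w := []) (by simp) ?_
    rw [update_frSt_vw]
    have he := runs_frEnd S F C hFC key (if C then pay.reverse else []) rest hkeyC
    refine he.of_eq ?_ ?_
    · have hor : (F || C) = (F || (k == ν)) := by
        rw [hC]; cases F <;> simp [beq_eq_decide]
      rw [hor]
      by_cases h : F = false ∧ k = ν
      · have : C = true := by rw [hC, decide_eq_true h]
        simp [this, h]
      · have : C = false := by rw [hC, decide_eq_false h]
        simp [this, h]
    · cases C <;> simp
  have hk4 : frSt S ([Γ'.blank] ++ rest) [Γ'.comma] [] (uflag C) (if C then pay.reverse else []) (uflag F) key [] (kr KR.dict2) =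
      Γ'.blank :: rest := by simp
  have h34 := h3.append (SegRuns.single hk4 h4)
  have := SegRuns.append h1 (SegRuns.cons hk2 h2 (h34.cast rfl (by simp) rfl le_rfl))
  refine this.cast rfl (by simp) rfl ?_
  have hkl : (rbits k).length = (encodeNat k).length := by simp [rbits]
  simp only [List.length_append, List.length_cons, List.length_map, List.length_nil, hkl]
  nlinarith [Nat.zero_le ((rbits ν).length * pay.length), Nat.zero_le ((rbits ν).length * (encodeNat k).length)]

/-- **The records.** [folklore] -/
theorem segRuns_fr_records : ∀ (recs : List (ℕ × List Γ')), (∀ r ∈ recs, Γ'.blank ∉ r.2) → ∀ (F : Bool) (key rest : List Γ'),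
    (F = false → key = []) →
    SegRuns (kr KR.dict2) frBody (wRecs recs) (frSt S (wRecs recs ++ rest) [] [] [] [] (uflag F) key [])
      (frSt S rest [] [] [] [] (uflag (F || recHas recs ν)) (if F then key else recPay recs ν ++ key) [])
      ((12 * (rbits ν).length + 34) * (wRecs recs).length)
  | [], _, F, key, rest, hkey => by
    have := SegRuns.nil (kr KR.dict2) frBody (frSt S rest [] [] [] [] (uflag F) key [])
    refine this.cast (by simp [wRecs]) (by simp [wRecs]) ?_ (by simp)
    cases F <;> simp [recHas, recPay, hkey]
  | (k, pay) :: recs, hrecs, F, key, rest, hkey => by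
    have hpay : Γ'.blank ∉ pay := hrecs (k, pay) (by simp)
    have h1 := segRuns_fr_record S ν hpr hx2 k pay hpay F key (wRecs recs ++ rest) hkey
    have h2 := segRuns_fr_records recs (fun r hr => hrecs r (by simp [hr])) (F || (k == ν)) (if F = false ∧ k = ν then pay else key) rest
      (by intro h; simp only [Bool.or_eq_false_iff, beq_eq_false_iff_ne] at h; rw [if_neg (by simp [h.2])]; exact hkey h.1)
    have := h1.append h2
    refine this.cast (by simp [wRecs]) (by simp [wRecs]) ?_ ?_
    · congr 1
      · simp [recHas, Bool.or_assoc]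
      · cases F with
        | true => simp
        | false =>
          by_cases hk : k = ν
          · subst hk; simp [recPay, hkey]
          · simp [recPay, hk]
    · simp only [wRecs, List.flatMap_cons, List.length_append]; nlinarith

/-- **Specification of `findRec`.** [folklore] -/
theorem runs_findRec (src : KR) (hsrc : src ≠ KR.dict2) (hst1 : src ≠ KR.t1) (hst2 : src ≠ KR.t2) (hsv : src ≠ KR.vw) (hse : src ≠ KR.ex)
    (hseb : src ≠ KR.eb) (hsl : src ≠ KR.lmd) (hsf : src ≠ KR.fnd) (hsk : src ≠ KR.key) (hsn : src ≠ KR.ne)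
    (recs : List (ℕ × List Γ')) (hrecs : ∀ r ∈ recs, Γ'.blank ∉ r.2) (hs : S (kr src) = wRecs recs)
    (ht1 : S (kr KR.t1) = []) (ht2 : S (kr KR.t2) = []) :
    Runs (findRec src) (frSt S [] [] [] [] [] [] [] []) (frSt S [] [] [] [] [] (uflag (recHas recs ν)) (recPay recs ν) [])
      ((12 * (rbits ν).length + 44) * (wRecs recs).length + 4) := by
  unfold findRec
  have h0 := runs_copyToG (a := kr src) (b := kr KR.dict2) (t₁ := kr KR.t1) (t₂ := kr KR.t2)
    (by simp [hsrc]) (by simp [hst1]) (by simp [hst2]) (by simp) (by simp) (by simp) (frSt S [] [] [] [] [] [] [] [])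
    (by simp [ht1]) (by simp [ht2]) (by simp)
  have hsr : frSt S [] [] [] [] [] [] [] [] (kr src) = wRecs recs := by
    rw [frSt_other] <;> first | exact hs | simp [hsrc, hsv, hse, hseb, hsl, hsf, hsk, hsn]
  rw [hsr, update_frSt_dict2] at h0
  have h1 := (segRuns_fr_records S ν hpr hx2 recs hrecs false [] [] (fun _ => rfl)).runs_loop_nil (by simp)
  simp only [List.append_nil, Bool.false_or] at h1
  refine (h0.seq h1).of_eq (by simp) (by nlinarith)

end FrSpec

/-- **`findRec` on any store** (hypothesis form): `fnd` and `key` receive the answer, everything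
else is unchanged. [folklore] -/
theorem runs_findRec' (R : RStore) (ν : ℕ) (src : KR) (hsrc : src ≠ KR.dict2) (hst1 : src ≠ KR.t1) (hst2 : src ≠ KR.t2)
    (hsv : src ≠ KR.vw) (hse : src ≠ KR.ex) (hseb : src ≠ KR.eb) (hsl : src ≠ KR.lmd) (hsf : src ≠ KR.fnd) (hsk : src ≠ KR.key)
    (hsn : src ≠ KR.ne) (recs : List (ℕ × List Γ')) (hrecs : ∀ r ∈ recs, Γ'.blank ∉ r.2) (hs : R (kr src) = wRecs recs)
    (hpr : R (kr KR.pr) = rbits ν) (hx2 : R (kr KR.x2) = []) (ht1 : R (kr KR.t1) = []) (ht2 : R (kr KR.t2) = [])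
    (hd2 : R (kr KR.dict2) = []) (hvw : R (kr KR.vw) = []) (hex : R (kr KR.ex) = []) (heb : R (kr KR.eb) = [])
    (hlmd : R (kr KR.lmd) = []) (hfnd : R (kr KR.fnd) = []) (hkey : R (kr KR.key) = []) (hne : R (kr KR.ne) = []) :
    Runs (findRec src) R (Function.update (Function.update R (kr KR.fnd) (uflag (recHas recs ν))) (kr KR.key) (recPay recs ν))
      ((12 * (rbits ν).length + 44) * (wRecs recs).length + 4) := by
  have e := frSt_eta R
  rw [hd2, hvw, hex, heb, hlmd, hfnd, hkey, hne] at e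
  have h := runs_findRec R ν hpr hx2 src hsrc hst1 hst2 hsv hse hseb hsl hsf hsk hsn recs hrecs hs ht1 ht2
  rw [e] at h
  refine h.of_eq ?_ le_rfl
  conv_rhs => rw [← e]
  rw [update_frSt_fnd, update_frSt_key]

/-! ### Small bricks for the occurrence table: the light test, colour lists, the least free colour -/

/-- `leCap cap`: test whether the unary count in `cnt` is at most `cap` (raising `fl` if so),
consuming up to `cap + 1` ticks of `cnt`. The bound is baked into the program. [folklore] -/
def leCap : ℕ → RProg
  | 0 => pop (kr KR.cnt) fun o => match o with
      | some _ => skip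
      | none => push (kr KR.fl) Γ'.blank
  | cap + 1 => pop (kr KR.cnt) fun o => match o with
      | some _ => leCap cap
      | none => push (kr KR.fl) Γ'.blank

/-- **Specification of `leCap`.** [folklore] -/
theorem runs_leCap : ∀ (cap : ℕ) (R : RStore), R (kr KR.fl) = [] → ∀ c : ℕ, R (kr KR.cnt) = ticks Γ'.blank c →
    Runs (leCap cap) R (Function.update (Function.update R (kr KR.cnt) (ticks Γ'.blank (c - (cap + 1)))) (kr KR.fl)
      (uflag (decide (c ≤ cap)))) (2 * cap + 3)
  | 0, R, hfl, c, hc => by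
    unfold leCap
    cases c with
    | zero =>
      refine (Runs.pop_nil (by rw [hc]; rfl) (Runs.push' ?_)).mono (by norm_num)
      have e : Function.update R (kr KR.cnt) (ticks Γ'.blank (0 - (0 + 1))) = R := Function.update_eq_self_iff.2 (by rw [hc])
      rw [hfl, e]; simp
    | succ c =>
      refine (Runs.pop_cons (k := kr KR.cnt) (a := Γ'.blank) (w := ticks Γ'.blank c) (by rw [hc, ticks_succ])
        ((Runs.skip _).of_eq ?_ le_rfl)).mono (by norm_num)
      have e1 : c + 1 - (0 + 1) = c := by omega
      have e2 : decide (c + 1 ≤ 0) = false := decide_eq_false (by omega)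
      rw [e1, e2, uflag_false]
      exact (Function.update_eq_self_iff.2 (by simp [hfl])).symm
  | cap + 1, R, hfl, c, hc => by
    unfold leCap
    cases c with
    | zero =>
      refine (Runs.pop_nil (by rw [hc]; rfl) (Runs.push' ?_)).mono (by omega)
      have e : Function.update R (kr KR.cnt) (ticks Γ'.blank (0 - (cap + 1 + 1))) = R :=
        Function.update_eq_self_iff.2 (by rw [hc, Nat.zero_sub])
      rw [hfl, e]; simp
    | succ c =>
      have ih := runs_leCap cap (Function.update R (kr KR.cnt) (ticks Γ'.blank c)) (by simp [hfl]) c (by simp)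
      refine (Runs.pop_cons (k := kr KR.cnt) (a := Γ'.blank) (w := ticks Γ'.blank c) (by rw [hc, ticks_succ]) (ih.of_eq ?_ le_rfl)).mono
        (by omega)
      rw [Function.update_idem]
      have e1 : c + 1 - (cap + 1 + 1) = c - (cap + 1) := by omega
      have e2 : decide (c + 1 ≤ cap + 1) = decide (c ≤ cap) := by simp
      rw [e1, e2]

/-- The word of a colour list: each colour in unary kets, closed by a comma. [folklore] -/
def wCols (L : List ℕ) : List Γ' := L.flatMap fun c => List.replicate c Γ'.ket ++ [Γ'.comma]

/-- `moveKets`: move the kets of `key` onto the candidate list `s2` and close them with a comma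
(so `s2`, read from the top, holds comma-first blocks). [folklore] -/
def moveKets : RProg := loop (kr KR.key) (fun _ => push (kr KR.s2) Γ'.ket) ;; push (kr KR.s2) Γ'.comma

/-- **Specification of `moveKets`.** [folklore] -/
theorem runs_moveKets (R : RStore) (c : ℕ) (hkey : R (kr KR.key) = List.replicate c Γ'.ket) :
    Runs moveKets R (Function.update (Function.update R (kr KR.key) []) (kr KR.s2) (Γ'.comma :: (List.replicate c Γ'.ket ++ R (kr KR.s2))))
      (3 * c + 2) := by
  unfold moveKets
  have hl : ∀ (n : ℕ) (R : RStore), R (kr KR.key) = List.replicate n Γ'.ket →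
      Runs (loop (kr KR.key) fun _ => push (kr KR.s2) Γ'.ket) R
        (Function.update (Function.update R (kr KR.key) []) (kr KR.s2) (List.replicate n Γ'.ket ++ R (kr KR.s2))) (3 * n + 1) := by
    intro n
    induction n with
    | zero =>
      intro R hk
      refine (Runs.loop_nil _ hk).of_eq ?_ (by omega)
      rw [List.replicate_zero, List.nil_append, Function.update_eq_self_iff.2 (by simp), Function.update_eq_self_iff.2 hk.symm]
    | succ n ih =>
      intro R hk
      rw [List.replicate_succ] at hk
      have hb : Runs (push (kr KR.s2) Γ'.ket) (Function.update R (kr KR.key) (List.replicate n Γ'.ket))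
          (Function.update (Function.update R (kr KR.key) (List.replicate n Γ'.ket)) (kr KR.s2) (Γ'.ket :: R (kr KR.s2))) 1 :=
        Runs.push' (by simp)
      have ih' := ih (Function.update (Function.update R (kr KR.key) (List.replicate n Γ'.ket)) (kr KR.s2) (Γ'.ket :: R (kr KR.s2)))
        (by simp)
      refine (Runs.loop_cons (f := fun _ => push (kr KR.s2) Γ'.ket) hk hb ih').of_eq ?_ (by omega)
      simp only [Function.update_self]
      rw [Function.update_comm (by simp), Function.update_idem, Function.update_comm (by simp)]
      simp [List.replicate_succ']
  refine ((hl c R hkey).seq (Runs.push' ?_)).of_eq rfl (by omega)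
  simp

/-! ### Membership of a colour in a colour list; the least free colour -/

/-- After comparing a block with the candidate: raise `u3` iff they were equal (neither flag up);
empty the flags. [folklore] -/
def eqTest : RProg :=
  pop (kr KR.fl2) fun o => match o with
    | some _ => clear (kr KR.fl3)
    | none => pop (kr KR.fl3) fun o' => match o' with
        | some _ => skip
        | none => setFlagG Γ'.blank (kr KR.u3)

/-- Body of the membership pass over the copy `s3` of the colour list: kets of the current block
to `s4`; at its comma compare with a copy of the candidate `c`. [folklore] -/
def mpBody (s : Γ') : RProg :=
  match s with
  | Γ'.ket => push (kr KR.s4) Γ'.ket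
  | Γ'.comma => copyToG (kr KR.c) (kr KR.s5) (kr KR.t1) (kr KR.t2) ;; cmpU (kr KR.s4) (kr KR.s5) (kr KR.fl2) (kr KR.fl3) Γ'.ket ;; eqTest
  | _ => skip

/-- `memPass`: raise `u3` if the candidate colour (kets in `c`, kept) occurs in the colour list
`cols` (kept). [folklore] -/
def memPass : RProg := copyToG (kr KR.cols) (kr KR.s3) (kr KR.t1) (kr KR.t2) ;; loop (kr KR.s3) mpBody

/-- `freshCol`: starting from the candidate `0` (`c` empty), increment the candidate while it
occurs in the colour list; ends with `c = ket^(freshNat L)`. [folklore] -/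
def freshCol : RProg :=
  push (kr KR.u2) Γ'.blank ;;
  whileLoop (kr KR.u2) (memPass ;; pop (kr KR.u3) fun o => match o with
    | some _ => push (kr KR.c) Γ'.ket ;; push (kr KR.u2) Γ'.blank
    | none => skip)

/-- The store family `mpSt` over a base store. [folklore] -/
def mpSt (S : RStore) (s3 s4 s5 fl2 fl3 u3 : List Γ') : RStore := fun r =>
  if r = kr KR.s3 then s3 else if r = kr KR.s4 then s4 else if r = kr KR.s5 then s5 else if r = kr KR.fl2 then fl2 else if r = kr KR.fl3 then fl3 else if r = kr KR.u3 then u3 else S r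

section MpstLemmas

variable (S : RStore) (s3 s4 s5 fl2 fl3 u3 w : List Γ')

/-- Reading `s3`. [folklore] -/
@[simp] theorem mpSt_s3 : mpSt S s3 s4 s5 fl2 fl3 u3 (kr KR.s3) = s3 := by simp [mpSt]
/-- Reading `s4`. [folklore] -/
@[simp] theorem mpSt_s4 : mpSt S s3 s4 s5 fl2 fl3 u3 (kr KR.s4) = s4 := by simp [mpSt]
/-- Reading `s5`. [folklore] -/
@[simp] theorem mpSt_s5 : mpSt S s3 s4 s5 fl2 fl3 u3 (kr KR.s5) = s5 := by simp [mpSt]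
/-- Reading `fl2`. [folklore] -/
@[simp] theorem mpSt_fl2 : mpSt S s3 s4 s5 fl2 fl3 u3 (kr KR.fl2) = fl2 := by simp [mpSt]
/-- Reading `fl3`. [folklore] -/
@[simp] theorem mpSt_fl3 : mpSt S s3 s4 s5 fl2 fl3 u3 (kr KR.fl3) = fl3 := by simp [mpSt]
/-- Reading `u3`. [folklore] -/
@[simp] theorem mpSt_u3 : mpSt S s3 s4 s5 fl2 fl3 u3 (kr KR.u3) = u3 := by simp [mpSt]
/-- Reading any other register. [folklore] -/
theorem mpSt_other {r : Reg} (h0 : r ≠ kr KR.s3) (h1 : r ≠ kr KR.s4) (h2 : r ≠ kr KR.s5) (h3 : r ≠ kr KR.fl2) (h4 : r ≠ kr KR.fl3) (h5 : r ≠ kr KR.u3) :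
    mpSt S s3 s4 s5 fl2 fl3 u3 r = S r := by simp [mpSt, h0, h1, h2, h3, h4, h5]
/-- Reading `cols`. [folklore] -/
@[simp] theorem mpSt_cols : mpSt S s3 s4 s5 fl2 fl3 u3 (kr KR.cols) = S (kr KR.cols) := by simp [mpSt]
/-- Reading `c`. [folklore] -/
@[simp] theorem mpSt_c : mpSt S s3 s4 s5 fl2 fl3 u3 (kr KR.c) = S (kr KR.c) := by simp [mpSt]
/-- Reading `t1`. [folklore] -/
@[simp] theorem mpSt_t1 : mpSt S s3 s4 s5 fl2 fl3 u3 (kr KR.t1) = S (kr KR.t1) := by simp [mpSt]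
/-- Reading `t2`. [folklore] -/
@[simp] theorem mpSt_t2 : mpSt S s3 s4 s5 fl2 fl3 u3 (kr KR.t2) = S (kr KR.t2) := by simp [mpSt]
/-- Reading `u2`. [folklore] -/
@[simp] theorem mpSt_u2 : mpSt S s3 s4 s5 fl2 fl3 u3 (kr KR.u2) = S (kr KR.u2) := by simp [mpSt]
/-- Updating `s3`. [folklore] -/
@[simp] theorem update_mpSt_s3 : Function.update (mpSt S s3 s4 s5 fl2 fl3 u3) (kr KR.s3) w = mpSt S w s4 s5 fl2 fl3 u3 := by
  funext r; by_cases h : r = kr KR.s3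
  · subst h; simp
  · rw [Function.update_of_ne h]; simp [mpSt, h]
/-- Updating `s4`. [folklore] -/
@[simp] theorem update_mpSt_s4 : Function.update (mpSt S s3 s4 s5 fl2 fl3 u3) (kr KR.s4) w = mpSt S s3 w s5 fl2 fl3 u3 := by
  funext r; by_cases h : r = kr KR.s4
  · subst h; simp
  · rw [Function.update_of_ne h]; simp [mpSt, h]
/-- Updating `s5`. [folklore] -/
@[simp] theorem update_mpSt_s5 : Function.update (mpSt S s3 s4 s5 fl2 fl3 u3) (kr KR.s5) w = mpSt S s3 s4 w fl2 fl3 u3 := by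
  funext r; by_cases h : r = kr KR.s5
  · subst h; simp
  · rw [Function.update_of_ne h]; simp [mpSt, h]
/-- Updating `fl2`. [folklore] -/
@[simp] theorem update_mpSt_fl2 : Function.update (mpSt S s3 s4 s5 fl2 fl3 u3) (kr KR.fl2) w = mpSt S s3 s4 s5 w fl3 u3 := by
  funext r; by_cases h : r = kr KR.fl2
  · subst h; simp
  · rw [Function.update_of_ne h]; simp [mpSt, h]
/-- Updating `fl3`. [folklore] -/
@[simp] theorem update_mpSt_fl3 : Function.update (mpSt S s3 s4 s5 fl2 fl3 u3) (kr KR.fl3) w = mpSt S s3 s4 s5 fl2 w u3 := by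
  funext r; by_cases h : r = kr KR.fl3
  · subst h; simp
  · rw [Function.update_of_ne h]; simp [mpSt, h]
/-- Updating `u3`. [folklore] -/
@[simp] theorem update_mpSt_u3 : Function.update (mpSt S s3 s4 s5 fl2 fl3 u3) (kr KR.u3) w = mpSt S s3 s4 s5 fl2 fl3 w := by
  funext r; by_cases h : r = kr KR.u3
  · subst h; simp
  · rw [Function.update_of_ne h]; simp [mpSt, h]

end MpstLemmas

/-- Every store is a `mpSt` over itself. [folklore] -/
theorem mpSt_eta (R : RStore) : mpSt R (R (kr KR.s3)) (R (kr KR.s4)) (R (kr KR.s5)) (R (kr KR.fl2)) (R (kr KR.fl3)) (R (kr KR.u3)) = R := by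
  funext r
  by_cases h0 : r = kr KR.s3; · subst h0; simp
  by_cases h1 : r = kr KR.s4; · subst h1; simp
  by_cases h2 : r = kr KR.s5; · subst h2; simp
  by_cases h3 : r = kr KR.fl2; · subst h3; simp
  by_cases h4 : r = kr KR.fl3; · subst h4; simp
  by_cases h5 : r = kr KR.u3; · subst h5; simp
  rw [mpSt_other _ _ _ _ _ _ _ h0 h1 h2 h3 h4 h5]

section MpSpec

variable (S : RStore) (m : ℕ) (hc : S (kr KR.c) = List.replicate m Γ'.ket) (ht1 : S (kr KR.t1) = []) (ht2 : S (kr KR.t2) = [])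
include hc ht1 ht2

omit hc ht1 ht2 in
/-- **`eqTest`.** [folklore] -/
theorem runs_eqTest (s3 : List Γ') (P Q : Prop) [Decidable P] [Decidable Q] (hPQ : ¬ (P ∧ Q)) (f : Bool) :
    Runs eqTest (mpSt S s3 [] [] (flagW Γ'.ket P) (flagW Γ'.ket Q) (uflag f))
      (mpSt S s3 [] [] [] [] (uflag (f || decide (¬ P ∧ ¬ Q)))) 8 := by
  unfold eqTest
  by_cases hP : P
  · have hQ : ¬ Q := fun hQ => hPQ ⟨hP, hQ⟩
    rw [flagW_true _ hP, flagW_false _ hQ]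
    have h := runs_clear (kr KR.fl3) (mpSt S s3 [] [] [] [] (uflag f))
    rw [mpSt_fl3, update_mpSt_fl3] at h
    have h' : Runs (clear (kr KR.fl3)) (mpSt S s3 [] [] [] [] (uflag f)) (mpSt S s3 [] [] [] [] (uflag (f || decide (¬ P ∧ ¬ Q)))) 1 := by
      refine h.of_eq ?_ (by simp)
      simp [hP]
    refine (Runs.pop_cons (k := kr KR.fl2) (a := Γ'.ket) (w := []) (by simp) ?_).mono (show 1 + 2 ≤ 8 by norm_num)
    rw [update_mpSt_fl2]; exact h'
  · rw [flagW_false _ hP]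
    refine Runs.pop_nil (by simp) ?_
    dsimp only
    by_cases hQ : Q
    · rw [flagW_true _ hQ]
      refine (Runs.pop_cons (k := kr KR.fl3) (a := Γ'.ket) (w := []) (by simp) ((Runs.skip _).of_eq ?_ le_rfl)).mono (by norm_num)
      rw [update_mpSt_fl3]; simp [hQ]
    · rw [flagW_false _ hQ]
      refine (Runs.pop_nil (by simp) ?_).mono (show 4 + 2 ≤ 6 by norm_num)
      dsimp only
      have h := runs_setFlagG Γ'.blank (kr KR.u3) (mpSt S s3 [] [] [] [] (uflag f)) (by cases f <;> simp)
      rw [update_mpSt_u3] at h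
      refine h.of_eq ?_ le_rfl
      simp [hP, hQ]

omit hc ht1 ht2 in
/-- Kets go to `s4`. [folklore] -/
theorem segRuns_mp_kets (u3 : List Γ') : ∀ (n : ℕ) (rest s4 : List Γ'),
    SegRuns (kr KR.s3) mpBody (List.replicate n Γ'.ket) (mpSt S (List.replicate n Γ'.ket ++ rest) s4 [] [] [] u3)
      (mpSt S rest (List.replicate n Γ'.ket ++ s4) [] [] [] u3) (3 * n)
  | 0, rest, s4 => by simpa using SegRuns.nil (kr KR.s3) mpBody _
  | n + 1, rest, s4 => by
    have hbody : Runs (mpBody Γ'.ket) (Function.update (mpSt S (Γ'.ket :: (List.replicate n Γ'.ket ++ rest)) s4 [] [] [] u3) (kr KR.s3)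
        (List.replicate n Γ'.ket ++ rest)) (mpSt S (List.replicate n Γ'.ket ++ rest) (Γ'.ket :: s4) [] [] [] u3) 1 := by
      rw [update_mpSt_s3]; unfold mpBody; exact Runs.push' (by simp)
    have ih := segRuns_mp_kets u3 n rest (Γ'.ket :: s4)
    have hk : mpSt S (Γ'.ket :: (List.replicate n Γ'.ket ++ rest)) s4 [] [] [] u3 (kr KR.s3) = Γ'.ket :: (List.replicate n Γ'.ket ++ rest) := by simp
    refine (SegRuns.cons hk hbody ih).cast (by simp [List.replicate_succ]) (by simp [List.replicate_succ]) ?_ (by omega)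
    simp [List.replicate_succ', List.append_assoc]

/-- **One block**: the kets, then the comparison at the comma. [folklore] -/
theorem segRuns_mp_block (cc : ℕ) (f : Bool) (rest : List Γ') :
    SegRuns (kr KR.s3) mpBody (List.replicate cc Γ'.ket ++ [Γ'.comma]) (mpSt S (List.replicate cc Γ'.ket ++ [Γ'.comma] ++ rest) [] [] [] [] (uflag f))
      (mpSt S rest [] [] [] [] (uflag (f || (cc == m)))) (12 * cc + 12 * m + 26) := by
  have h1 := segRuns_mp_kets S (uflag f) cc ([Γ'.comma] ++ rest) []
  rw [List.append_nil] at h1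
  have h2 : Runs (mpBody Γ'.comma) (Function.update (mpSt S ([Γ'.comma] ++ rest) (List.replicate cc Γ'.ket) [] [] [] (uflag f)) (kr KR.s3) rest)
      (mpSt S rest [] [] [] [] (uflag (f || (cc == m)))) ((10 * m + 3) + (9 * cc + 2 * m + 9) + 8) := by
    rw [update_mpSt_s3]; unfold mpBody
    have hcp := runs_copyToG (a := kr KR.c) (b := kr KR.s5) (t₁ := kr KR.t1) (t₂ := kr KR.t2)
      (by simp) (by simp) (by simp) (by simp) (by simp) (by simp) (mpSt S rest (List.replicate cc Γ'.ket) [] [] [] (uflag f))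
      (by simp [ht1]) (by simp [ht2]) (by simp)
    rw [mpSt_c, hc, update_mpSt_s5, List.length_replicate] at hcp
    have hcmp := runs_cmpU (a := kr KR.s4) (b := kr KR.s5) (gt := kr KR.fl2) (lt := kr KR.fl3)
      (by simp) (by simp) (by simp) (by simp) (by simp) (by simp) Γ'.ket (mpSt S rest [] [] [] [] (uflag f)) cc m False False
      (by simp [flagW])
    have ecs : cmpSt (kr KR.s4) (kr KR.s5) (kr KR.fl2) Γ'.ket (mpSt S rest [] [] [] [] (uflag f)) cc m False =
        mpSt S rest (List.replicate cc Γ'.ket) (List.replicate m Γ'.ket) [] [] (uflag f) := by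
      simp [cmpSt, flagW]
    have ecs' : Function.update (cmpSt (kr KR.s4) (kr KR.s5) (kr KR.fl2) Γ'.ket (mpSt S rest [] [] [] [] (uflag f)) 0 0 (False ∨ m < cc))
        (kr KR.fl3) (flagW Γ'.ket (False ∨ cc < m)) = mpSt S rest [] [] (flagW Γ'.ket (m < cc)) (flagW Γ'.ket (cc < m)) (uflag f) := by
      simp only [cmpSt, false_or, List.replicate_zero, update_mpSt_s4, update_mpSt_s5, update_mpSt_fl2, update_mpSt_fl3]
    rw [ecs, ecs'] at hcmp
    have heq := runs_eqTest S rest (m < cc) (cc < m) (by omega) f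
    have e3 : decide (¬ m < cc ∧ ¬ cc < m) = (cc == m) := by
      by_cases h : cc = m
      · subst h; simp
      · have : m < cc ∨ cc < m := by omega
        rcases this with h' | h' <;> simp [h', h]
    rw [e3] at heq
    exact hcp.seq (hcmp.seq heq)
  have hk : mpSt S ([Γ'.comma] ++ rest) (List.replicate cc Γ'.ket) [] [] [] (uflag f) (kr KR.s3) = Γ'.comma :: rest := by simp
  have := h1.append (SegRuns.single hk h2)
  refine this.cast rfl (by simp) rfl ?_
  omega

/-- **The blocks.** [folklore] -/
theorem segRuns_mp_blocks : ∀ (L : List ℕ) (f : Bool) (rest : List Γ'),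
    SegRuns (kr KR.s3) mpBody (wCols L) (mpSt S (wCols L ++ rest) [] [] [] [] (uflag f))
      (mpSt S rest [] [] [] [] (uflag (f || decide (m ∈ L)))) ((12 * m + 37) * (wCols L).length)
  | [], f, rest => by simpa [wCols] using SegRuns.nil (kr KR.s3) mpBody _
  | cc :: L, f, rest => by
    have h1 := segRuns_mp_block S m hc ht1 ht2 cc f (wCols L ++ rest)
    have h2 := segRuns_mp_blocks L (f || (cc == m)) rest
    have := h1.append h2
    refine this.cast (by simp [wCols]) (by simp [wCols]) ?_ ?_
    · congr 2
      by_cases h : cc = m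
      · subst h; simp
      · have hb : (cc == m) = false := beq_eq_false_iff_ne.2 h
        simp [hb, Ne.symm h]
    · simp only [wCols, List.flatMap_cons, List.length_append, List.length_replicate, List.length_singleton]
      nlinarith

/-- **Specification of `memPass`.** [folklore] -/
theorem runs_memPass (L : List ℕ) (hcols : S (kr KR.cols) = wCols L) (f : Bool) :
    Runs memPass (mpSt S [] [] [] [] [] (uflag f)) (mpSt S [] [] [] [] [] (uflag (f || decide (m ∈ L)))) ((12 * m + 47) * (wCols L).length + 4) := by
  unfold memPass
  have h0 := runs_copyToG (a := kr KR.cols) (b := kr KR.s3) (t₁ := kr KR.t1) (t₂ := kr KR.t2)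
    (by simp) (by simp) (by simp) (by simp) (by simp) (by simp) (mpSt S [] [] [] [] [] (uflag f)) (by simp [ht1]) (by simp [ht2]) (by simp)
  rw [mpSt_cols, hcols, update_mpSt_s3] at h0
  have h1 := (segRuns_mp_blocks S m hc ht1 ht2 L f []).runs_loop_nil (by simp)
  rw [List.append_nil] at h1
  exact (h0.seq h1).mono (by nlinarith)

end MpSpec

/-- **Specification of `freshCol`**: with the colour list `L` in `cols` and `c`, `u2`, `u3`, the
pass registers empty, `c` ends as `ket^(freshNat L)`. [folklore] -/
theorem runs_freshCol (S : RStore) (L : List ℕ) (hcols : S (kr KR.cols) = wCols L) (hc : S (kr KR.c) = []) (ht1 : S (kr KR.t1) = [])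
    (ht2 : S (kr KR.t2) = []) (hu2 : S (kr KR.u2) = []) (hs3 : S (kr KR.s3) = []) (hs4 : S (kr KR.s4) = []) (hs5 : S (kr KR.s5) = [])
    (hfl2 : S (kr KR.fl2) = []) (hfl3 : S (kr KR.fl3) = []) (hu3 : S (kr KR.u3) = []) :
    Runs freshCol S (Function.update S (kr KR.c) (List.replicate (freshNat L) Γ'.ket))
      ((((12 * freshNat L + 47) * (wCols L).length + 10) + 2) * (freshNat L + 1) + 1 + 1) := by
  set N := freshNat L + 1 with hN
  set F : ℕ → RStore := fun i => Function.update S (kr KR.c) (List.replicate (min i (freshNat L)) Γ'.ket) with hF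
  have hF0 : F 0 = S := by rw [hF]; simp only [Nat.zero_min, List.replicate_zero]; exact Function.update_eq_self_iff.2 hc.symm
  have hgo : ∀ i, F i (kr KR.u2) = [] := fun i => by simp [hF, hu2]
  have hmp : ∀ i, mpSt (F i) [] [] [] [] [] (uflag false) = F i := fun i => by
    have e := mpSt_eta (F i)
    simp only [hF, ne_eq, reduceCtorEq, not_false_eq_true, Function.update_of_ne, Sum.inr.injEq, hs3, hs4, hs5, hfl2, hfl3, hu3] at e ⊢
    exact e
  have hstep : ∀ i, i < N → Runs (memPass ;; pop (kr KR.u3) fun o => match o with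
      | some _ => push (kr KR.c) Γ'.ket ;; push (kr KR.u2) Γ'.blank
      | none => skip) (F i) (Function.update (F (i + 1)) (kr KR.u2) (if i + 1 < N then [Γ'.blank] else []))
      (((12 * freshNat L + 47) * (wCols L).length + 4) + 6) := by
    intro i hi
    have hmin : min i (freshNat L) = i := min_eq_left (by omega)
    have h1 := runs_memPass (F i) i (by simp [hF, hmin]) (by simp [hF, ht1]) (by simp [hF, ht2]) L (by simp [hF, hcols]) false
    rw [hmp i, Bool.false_or] at h1
    have hle : (12 * i + 47) * (wCols L).length ≤ (12 * freshNat L + 47) * (wCols L).length := Nat.mul_le_mul_right _ (by omega)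
    have h1' : Runs memPass (F i) (Function.update (F i) (kr KR.u3) (uflag (decide (i ∈ L))))
        ((12 * freshNat L + 47) * (wCols L).length + 4) := by
      refine h1.of_eq ?_ (by omega)
      conv_rhs => rw [← hmp i]
      rw [update_mpSt_u3]
    by_cases hlt : i < freshNat L
    · have hmem : i ∈ L := mem_of_lt_freshNat hlt
      rw [decide_eq_true hmem] at h1'
      have h2 : Runs (pop (kr KR.u3) fun o => match o with
          | some _ => push (kr KR.c) Γ'.ket ;; push (kr KR.u2) Γ'.blank
          | none => skip) (Function.update (F i) (kr KR.u3) (uflag true))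
          (Function.update (F (i + 1)) (kr KR.u2) (if i + 1 < N then [Γ'.blank] else [])) ((1 + 1) + 2) := by
        refine Runs.pop_cons (k := kr KR.u3) (a := Γ'.blank) (w := []) (by simp) ?_
        have eX : Function.update (Function.update (F i) (kr KR.u3) (uflag true)) (kr KR.u3) [] = F i := by
          rw [Function.update_idem]; exact Function.update_eq_self_iff.2 (by simp [hF, hu3])
        rw [eX]
        have hmin' : min (i + 1) (freshNat L) = i + 1 := min_eq_left (by omega)
        refine (Runs.push' (R' := F (i + 1)) ?_).seq (Runs.push' ?_)
        · simp only [hF, hmin, hmin', Function.update_self, Function.update_idem, List.replicate_succ]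
        · rw [if_pos (by omega), hgo]
      exact (h1'.seq h2).mono (by omega)
    · have hi' : i = freshNat L := by omega
      have hmem : i ∉ L := hi' ▸ freshNat_not_mem L
      rw [decide_eq_false hmem] at h1'
      have h2 : Runs (pop (kr KR.u3) fun o => match o with
          | some _ => push (kr KR.c) Γ'.ket ;; push (kr KR.u2) Γ'.blank
          | none => skip) (Function.update (F i) (kr KR.u3) (uflag false))
          (Function.update (F (i + 1)) (kr KR.u2) (if i + 1 < N then [Γ'.blank] else [])) (0 + 2) := by
        refine Runs.pop_nil (by simp) ((Runs.skip _).of_eq ?_ le_rfl)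
        rw [if_neg (by omega), uflag_false, Function.update_eq_self_iff.2 (by simp [hF, hu3])]
        have e1 : F (i + 1) = F i := by simp only [hF, hi']; simp
        rw [e1]; exact (Function.update_eq_self_iff.2 (hgo i).symm).symm
      exact (h1'.seq h2).mono (by omega)
  have hw := runs_whileLoop (kr KR.u2) Γ'.blank _ F N _ (by omega) hgo hstep
  unfold freshCol
  have h0 : Runs (push (kr KR.u2) Γ'.blank) S (Function.update (F 0) (kr KR.u2) [Γ'.blank]) 1 := Runs.push' (by rw [hF0, hu2])
  refine (h0.seq hw).of_eq ?_ ?_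
  · simp [hF, hN]
  · rw [hN, show (12 * freshNat L + 47) * (wCols L).length + 4 + 6 = (12 * freshNat L + 47) * (wCols L).length + 10 by omega]
    omega

end Literature.Computability.FineGrained.IPRenameM
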